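import Summits.BirchSwinnertonDyer.BirchSwinnertonDyer.Theorems.RamifiedHeegnerPairLeafRankZeroUpperAtThreeSocket
import Summits.BirchSwinnertonDyer.Rank1Residual.X11b.TwistTransportIrr
import Literature.NumberTheory.EllipticCurves.Rank1Residual.PrintShape
import HarnessLib

/-!
# Route `RamifiedHeegnerPair`, U₀-side (item 26024) — the rank-zero-side twist-unit datum TU₀ at a Heegner frame IS a Heegner-index identity:
# `ord₃ #Ш_an(E^{(d_K)}) = 2·ord₃ [E(K) : ℤP] − 2·ord₃ c − ord₃ (L(E,1)/Ω_E) − ord₃ ∏_ℓ c_ℓ(E)` (certificate shape for TU₀)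

HONEST FRAMING. Theorems only; helper file (`--supports stmt-BirchSwinnertonDyer-26024`); nothing is booked, no item is closed, BSD is not proved
for any curve. Lead prover bsd-line-rhp-p2 g7, 2026-08-28. Companion of `…LeafRankZeroUpperAtThreeTwistUnit.lean` (p631701: U₀ ⟸ PUB₀⁺ ∧ S2 ∧ Σ★″ ∧
TU₀) and `…LeafTwistUnitCertificate.lean` (p632827: the rank-one-side datum is a modular-symbol inequality).

WHAT. For a rank-ZERO leaf curve `W` the twist-unit datum TU₀ asks for a Heegner field `K` whose rank-ONE twist `Wd` has `ord₃ #Ш_an(Wd) ≤ 0`; `#Ш_an(Wd)`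
carries a regulator, so it is not a modular-symbol quantity — but at a Heegner frame `(Dt, H, ι, P)` of `W` over `K` the tree's swapped Gross–Zagier
display (`TwistIdentity.padicValRat_add_eq_of_grossZagier_swap`, CGLS22 (5.6) with the ranks exchanged: `ord₃ q₀ + ord₃ q_d = 2·ord₃[E(K):ℤP] − 2·ord₃ c
− 2·ord₃ #E(K)_tors`) turns it into an identity between the HEEGNER INDEX, the Manin constant of the datum, the modular-symbol value `q₀ = L(W,1)/Ω_W`
and `∏c(W)`:

* `padicValRat_shaAn_heegnerTwist_rankOne_three` — `W` leaf (`Addv W 3`, `SubGss W 3`; so `W[3]`, `Wd[3]` irreducible and all torsion valuations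
  vanish, and `ord₃ ∏c(Wd) = ord₃ ∏c(W)`), `r_an(W) = 0`, `K` imaginary quadratic with odd `d_K`, Heegner for `N_W`, `Wd = Cd • W^{(d_K)}` globally minimal
  of analytic rank `1`, `#Ш_an(Wd) = q_d ∈ ℚ`, `L(W,1)/Ω_W = q₀ ∈ ℚ`; PUBLISHED binders at the frame: Gross–Zagier, Kolyvagin, GZK, Version L. Then
  `ord₃ q_d = 2·ord₃ [E(K):ℤP] − 2·ord₃ c(Dt) − ord₃ q₀ − ord₃ ∏_ℓ c_ℓ(W)`.
* `padicValRat_shaAn_twist_nonpos_iff_index` — hence the unit clause of TU₀ at `(K, Wd)` ⟺ `2·ord₃ [E(K):ℤP] ≤ 2·ord₃ c(Dt) + ord₃ q₀ + ord₃ ∏_ℓ c_ℓ(W)`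
  (for a lattice-optimal datum of a leaf curve `3 ∤ c`, Manin discharged: then ⟺ `2·ord₃ [E(K):ℤP] ≤ ord₃ (L(W,1)/Ω_W) + ord₃ ∏c(W)`).

So the TU₀ census (trib-w-rhp) per class = one Heegner `d` with `r_an(E^{(d)}) = 1` and the Heegner index of the optimal member at that depth — the
j294980-type instrument. Nothing asserted about any curve; the display's published inputs are hypotheses. References:
[cite: CastellaGrossiLeeSkinner2022, proof of Thm. 5.3.1, display (5.6)] [cite: GrossZagier1986, I.(6.5), V.§2 (pp. 310–312)] [cite: Mazur1977, Ch. III §5, p. 157]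
[cite: Miller2011LMS, §1 and Def. 1.1 (arXiv:1010.2431 p. 3)] [cite: JetchevSkinnerWan2017, §7.4.1].
-/

-- D-0017: single-problem summit, so `Summit.BirchSwinnertonDyer.BirchSwinnertonDyer.…` repeats a namespace BY DESIGN.
set_option linter.dupNamespace false
set_option autoImplicit false

noncomputable section

open scoped Classical NumberField

open WeierstrassCurve IsDedekindDomain IsDedekindDomain.HeightOneSpectrum NumberField
  Rat.HeightOneSpectrum Literature Literature.NumberTheory.EllipticCurves
  Literature.NumberTheory.EllipticCurves.ModularForms
  Literature.NumberTheory.EllipticCurves.Rank1Residual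
  Literature.NumberTheory.EllipticCurves.Rank1Residual.Typed
  Literature.NumberTheory.EllipticCurves.KrizLi2019
  Literature.NumberTheory.QuadraticFields
  Summit.BirchSwinnertonDyer.Rank1Residual
  Summit.BirchSwinnertonDyer.Rank1Residual.Additive
  Summit.BirchSwinnertonDyer.Rank1Residual.X11b.Three
  Summit.BirchSwinnertonDyer.BirchSwinnertonDyer.Theses.RamifiedHeegnerPair
  Summit.BirchSwinnertonDyer.BirchSwinnertonDyer.Theorems
  Summit.BirchSwinnertonDyer.BirchSwinnertonDyer.Theorems.SchneiderFree

namespace Summit.BirchSwinnertonDyer.BirchSwinnertonDyer.Theorems.RamifiedPairUpperBound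

/-- **`ord₃ #Ш_an` of the rank-ONE Heegner twist of a rank-ZERO leaf curve, read at a Heegner frame.** See the module docstring: the valuation
bookkeeping of `jointUpperBoundAt_three_of_indexUpper_rankZero` (p611715 §1) carried to an EQUALITY — `#Ш_an(Wd) = q_d`, `q_d' := L′(Wd,1)/(Ω·Reg) =
q_d·∏c(Wd)/t_d²`, the swapped display `ord q₀ + ord q_d' = 2·ord I − 2·ord c − 2·ord t_K`, all torsion valuations `0` (irreducibility of `W[3]`, `Wd[3]`,
`AdditivePotMult.padicValNat_torsionOrder_baseChange_quadratic_anyRank`), `ord₃ ∏c(Wd) = ord₃ ∏c(W)` (Heegner twist). CONDITIONAL on the displayed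
published binders; nothing asserted. [cite: CastellaGrossiLeeSkinner2022, proof of Thm. 5.3.1, display (5.6)] [cite: Mazur1977, Ch. III §5, p. 157]
[cite: Miller2011LMS, §1 and Def. 1.1 (arXiv:1010.2431 p. 3)] -/
theorem padicValRat_shaAn_heegnerTwist_rankOne_three
    (W : WeierstrassCurve ℚ) [W.IsElliptic] [W.IsGloballyMinimal] [NeZero (W.conductorNorm ℤ)]
    (hadd : Addv W 3) (hsub : SubGss W 3) (hr : W.analyticRank = 0)
    (K : Type) [Field K] [NumberField K]
    (Dt : ModularParametrizationData W (W.conductorNorm ℤ))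
    (H : HeegnerDatum (W.conductorNorm ℤ) (NumberField.discr K)) (ι : K →+* ℂ)
    (P : (W.baseChange K).toAffine.Point)
    (Wd : WeierstrassCurve ℚ) [Wd.IsElliptic] [Wd.IsGloballyMinimal] (Cd : VariableChange ℚ)
    (hGZ : gross_zagier (W.conductorNorm ℤ) W K) (hKo : kolyvagin (W.conductorNorm ℤ) W K)
    (hGZK : rank_eq_analyticRank_of_analyticRank_le_one) (hmod : hasEntireLFunction_rat)
    (hK : IsImaginaryQuadratic K) (hHN : SatisfiesHeegnerHypothesis (W.conductorNorm ℤ) K)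
    (hodd : Odd (NumberField.discr K))
    (hP : WeierstrassCurve.Affine.Point.map ι.toRatAlgHom P = heegnerPointComplex Dt H)
    (hWd : Cd • W.quadraticTwist (NumberField.discr K : ℚ) = Wd) (hrd : Wd.analyticRank = 1)
    {q0 : ℚ} (hq0 : W.entireLFunction 1 / (W.realPeriodRat : ℂ) = (q0 : ℂ))
    {qd : ℚ} (hqd : shaAn Wd = (qd : ℂ)) :
    padicValRat 3 qd = 2 * (padicValNat 3 (AddSubgroup.zmultiples P).index : ℤ) - 2 * padicValNat 3 Dt.c.natAbs -
      padicValRat 3 q0 - padicValNat 3 W.tamagawaProduct := by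
  have hirr : W.HasIrreducibleModPGaloisRep 3 := (classX4_three_of_addv_of_subGss W hadd hsub).2.2
  have hirrd : Wd.HasIrreducibleModPGaloisRep 3 := X11b.hasIrreducibleModPGaloisRep_twist_model W 3 K hK.1 hirr Cd hWd
  have hD0 : (NumberField.discr K : ℚ) ≠ 0 := by exact_mod_cast NumberField.discr_ne_zero K
  haveI hEt : (W.quadraticTwist (NumberField.discr K : ℚ)).IsElliptic := W.isElliptic_quadraticTwist hD0
  -- `d_K < -4`: `3 ∣ N_E` splits (`d_K ≠ -3`), `d_K` odd, so `w_K = 2` is prime to `3`; the twist is minimal at `3` (`ord₃ u = 0`)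
  have h3N : 3 ∣ W.conductorNorm ℤ :=
    (W.dvd_conductorNorm_iff_not_hasGoodReductionAtPrime 3).mpr (not_good_of_addv W 3 hadd)
  have h3 : NumberField.discr K ≠ -3 := by
    intro h
    exact (X11b.Three.not_dvd_discr_and_not_dvd_torsionOrder_of_heegner hK hHN (by decide) h3N).1
      (h ▸ ⟨-1, by norm_num⟩)
  have hd4 : NumberField.discr K < -4 := by
    haveI : IsTotallyComplex K := hK.2
    have hneg : NumberField.discr K < 0 := WeierstrassCurve.discr_neg_of_finrank_eq_two K hK.1
    have hmod4 := Quadratic.discr_emod_four (K := K) hK.1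
    rcases hodd with ⟨k, hk⟩
    omega
  have hμ : ¬ 3 ∣ Units.torsionOrder K := by
    rw [Quadratic.torsionOrder_eq_two_of_discr_lt_neg_four hK.1 hd4]; omega
  have hu : padicValRat 3 (Cd.u : ℚ) = 0 :=
    AdditivePotMult.padicValRat_u_eq_zero_of_twist_minimal_of_dvd W 3 K hK hHN h3N Cd hWd
  -- positivity
  have hΩd : (Wd.realPeriodRat : ℂ) ≠ 0 := by exact_mod_cast Wd.realPeriodRat_pos_holds.ne'
  have hRd : (Wd.regulator : ℂ) ≠ 0 := by exact_mod_cast Wd.regulator_pos'.ne'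
  have hcd0 : (Wd.tamagawaProduct : ℂ) ≠ 0 := by exact_mod_cast Wd.tamagawaProduct_pos_holds.ne'
  have htd0 : (Wd.torsionOrder : ℂ) ≠ 0 := by exact_mod_cast Wd.torsionOrder_pos_holds.ne'
  have hcdQ : (Wd.tamagawaProduct : ℚ) ≠ 0 := by exact_mod_cast Wd.tamagawaProduct_pos_holds.ne'
  have htdQ : (Wd.torsionOrder : ℚ) ≠ 0 := by exact_mod_cast Wd.torsionOrder_pos_holds.ne'
  have hΩW : (W.realPeriodRat : ℂ) ≠ 0 := by exact_mod_cast W.realPeriodRat_pos_holds.ne'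
  -- `L′(Wd,1)/(Ω·Reg) = #Ш_an(Wd)·∏c(Wd)/t_d²`
  have hL : Wd.leadingLCoeff =
      (qd : ℂ) * ((Wd.realPeriodRat : ℂ) * (Wd.tamagawaProduct : ℂ) * (Wd.regulator : ℂ)) /
        (Wd.torsionOrder : ℂ) ^ 2 := by
    rw [shaAn_def] at hqd
    rw [← hqd]
    field_simp
  have hqd' : Wd.leadingLCoeff / ((Wd.realPeriodRat * Wd.regulator : ℝ) : ℂ) =
      ((qd * (Wd.tamagawaProduct : ℚ) / (Wd.torsionOrder : ℚ) ^ 2 : ℚ) : ℂ) := by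
    rw [hL]
    push_cast
    field_simp
  -- the swapped Gross–Zagier display (Manin constant kept)
  have hid := TwistIdentity.padicValRat_add_eq_of_grossZagier_swap W 3 (W.conductorNorm ℤ) K Dt H ι P hGZ hKo hGZK
    hmod hK hHN hP (by norm_num) hμ hr Wd Cd hWd hu hrd q0 (qd * (Wd.tamagawaProduct : ℚ) / (Wd.torsionOrder : ℚ) ^ 2)
    hq0 hqd'
  -- torsion valuations vanish (irreducibility), `t_K` included
  have htW : padicValNat 3 W.torsionOrder = 0 := padicValNat_torsionOrder_eq_zero_of_irreducible W 3 hirr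
  have htd : padicValNat 3 Wd.torsionOrder = 0 := padicValNat_torsionOrder_eq_zero_of_irreducible Wd 3 hirrd
  have htK : padicValNat 3 (W.baseChange K).torsionOrder = 0 := by
    obtain ⟨θ, c, hθ, hcθ⟩ := Quadratic.exists_sq_eq_algebraMap (F := ℚ) (K := K) hK.1
    obtain ⟨qq, hqq, hdq⟩ := NumberField.exists_discr_eq_mul_sq hK.1 hθ hcθ
    rw [AdditivePotMult.padicValNat_torsionOrder_baseChange_quadratic_anyRank W K hK.1 hθ hcθ hqq hdq Wd ⟨Cd, hWd⟩
      3 (by norm_num), htW, htd]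
  -- Tamagawa transport along the twist
  have h3d : ¬ ((3 : ℕ) : ℤ) ∣ NumberField.discr K :=
    Literature.SatisfiesHeegnerHypothesis.not_dvd_discr hK.1 hHN Nat.prime_three h3N
  have htam : padicValNat 3 Wd.tamagawaProduct = padicValNat 3 W.tamagawaProduct :=
    X2.padicValNat_tamagawaProduct_twist_of_heegner_of_odd W 3 (by norm_num) K hK hodd h3d hHN Cd hWd
  -- non-vanishing of `q_d` (`L′(Wd,1) ≠ 0`)
  obtain ⟨hleadd, hderivd⟩ := leadingLCoeff_eq_deriv_of_analyticRank_eq_one hrd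
  have hqd0 : qd ≠ 0 := by
    intro h0
    apply hderivd
    rw [← hleadd, hL, h0]
    simp
  -- the valuation of `q_d' = q_d·∏c(Wd)/t_d²`
  have v2 : padicValRat 3 (qd * (Wd.tamagawaProduct : ℚ) / (Wd.torsionOrder : ℚ) ^ 2) =
      padicValRat 3 qd + padicValNat 3 Wd.tamagawaProduct - 2 * padicValNat 3 Wd.torsionOrder := by
    rw [padicValRat.div (mul_ne_zero hqd0 hcdQ) (pow_ne_zero _ htdQ), padicValRat.mul hqd0 hcdQ,
      padicValRat.pow, padicValRat.of_nat, padicValRat.of_nat]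
    ring
  have hcI : (padicValInt 3 Dt.c : ℤ) = (padicValNat 3 Dt.c.natAbs : ℤ) := rfl
  rw [v2, hcI, htK, htd, htam] at hid
  simp only [Nat.cast_zero, mul_zero, sub_zero] at hid
  linarith

/-- **The unit clause of TU₀ at a Heegner frame is a Heegner-index inequality.** Under the hypotheses of
`padicValRat_shaAn_heegnerTwist_rankOne_three`: `ord₃ #Ш_an(Wd) ≤ 0 ⟺ 2·ord₃ [E(K):ℤP] ≤ 2·ord₃ c(Dt) + ord₃ (L(W,1)/Ω_W) + ord₃ ∏_ℓ c_ℓ(W)`.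
So a TU₀ certificate for a rank-zero leaf class = one Heegner `d` (odd, every `ℓ ∣ N` split, `L(E^{(d)},s)` with a simple zero at `1`) and the `3`-adic
valuation of the Heegner index of a parametrisation datum (for the lattice-optimal datum `3 ∤ c`). Nothing asserted about any curve.
[cite: CastellaGrossiLeeSkinner2022, proof of Thm. 5.3.1, display (5.6)] [cite: JetchevSkinnerWan2017, §7.4.1] [cite: Miller2011LMS, §1 and Def. 1.1] -/
theorem padicValRat_shaAn_twist_nonpos_iff_index
    (W : WeierstrassCurve ℚ) [W.IsElliptic] [W.IsGloballyMinimal] [NeZero (W.conductorNorm ℤ)]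
    (hadd : Addv W 3) (hsub : SubGss W 3) (hr : W.analyticRank = 0)
    (K : Type) [Field K] [NumberField K]
    (Dt : ModularParametrizationData W (W.conductorNorm ℤ))
    (H : HeegnerDatum (W.conductorNorm ℤ) (NumberField.discr K)) (ι : K →+* ℂ)
    (P : (W.baseChange K).toAffine.Point)
    (Wd : WeierstrassCurve ℚ) [Wd.IsElliptic] [Wd.IsGloballyMinimal] (Cd : VariableChange ℚ)
    (hGZ : gross_zagier (W.conductorNorm ℤ) W K) (hKo : kolyvagin (W.conductorNorm ℤ) W K)
    (hGZK : rank_eq_analyticRank_of_analyticRank_le_one) (hmod : hasEntireLFunction_rat)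
    (hK : IsImaginaryQuadratic K) (hHN : SatisfiesHeegnerHypothesis (W.conductorNorm ℤ) K)
    (hodd : Odd (NumberField.discr K))
    (hP : WeierstrassCurve.Affine.Point.map ι.toRatAlgHom P = heegnerPointComplex Dt H)
    (hWd : Cd • W.quadraticTwist (NumberField.discr K : ℚ) = Wd) (hrd : Wd.analyticRank = 1)
    {q0 : ℚ} (hq0 : W.entireLFunction 1 / (W.realPeriodRat : ℂ) = (q0 : ℂ))
    {qd : ℚ} (hqd : shaAn Wd = (qd : ℂ)) :
    padicValRat 3 qd ≤ 0 ↔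
      2 * (padicValNat 3 (AddSubgroup.zmultiples P).index : ℤ) ≤
        2 * padicValNat 3 Dt.c.natAbs + padicValRat 3 q0 + padicValNat 3 W.tamagawaProduct := by
  have h := padicValRat_shaAn_heegnerTwist_rankOne_three W hadd hsub hr K Dt H ι P Wd Cd hGZ hKo hGZK hmod hK hHN hodd hP hWd hrd
    hq0 hqd
  constructor
  · intro hle; linarith
  · intro hle; linarith

end Summit.BirchSwinnertonDyer.BirchSwinnertonDyer.Theorems.RamifiedPairUpperBound

end
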